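import Summits.CriticalPhenomena.SAWScalingLimit.Theses.SAWMassiveIsingTilt
import Summits.CriticalPhenomena.SAWScalingLimit.Theorems.SAWMassiveIsingTiltDefs
import Literature.Probability.RandomPlanarGeometry.ConformalRestrictionHolds
import Literature.Probability.RandomPlanarGeometry.ConformalRestrictionLocal
import Literature.Probability.RandomPlanarGeometry.HullRestrictionSLEHolds
import Literature.Probability.RandomPlanarGeometry.CritPercSLESimplePathHolds
import Literature.Probability.RandomPlanarGeometry.SLEExistenceNeEightHolds
import Summits.CriticalPhenomena.SAWScalingLimit.Theorems.SAWMassiveIsingTiltHexEndpointApproxExists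
import HarnessLib

/-!
# Crux `MassiveWindowSLE` (stmt-CriticalPhenomena-7685), line `registered` (skeleton r6):
stub `stub_windowNesting` — nesting of the discrete domains along common endpoints

Route `SAWMassiveIsingTilt` of `CriticalPhenomena/SAWScalingLimit`; lead prover c2 of the line
`registered` (skeleton r6). Stub N (tag `wn`, lattice geometry) of the skeleton, the r6 split of
the former stub 2a (window restriction defect).

What. The line compares the window laws of a Dobrushin domain `D` and of a HULL SUBDOMAIN `D'` of
`D` (`MarkedDomain.IsHullSubdomain`) along COMMON honeycomb lattice endpoints `a δ, b δ`
(`SAW.IsEmbEndpointApprox hexGraph hexCenter` of both `(D; a, b)` and `(D'; a, b)`). Restriction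
needs that the two discrete domains `Ω_δ ⊇ Ω'_δ` carry the SAME self-avoiding walks away from the
removed hull `K = closure (D ∖ D')`. For every `ε > 0` and all small `δ > 0`:

* (i) every `Ω'_δ`-SAW from `a δ` to `b δ` is, with the same support (hence the same polyline and
  the same vertex count), an `Ω_δ`-SAW (`wn_transfer_of_subset`): mesh vertices of `D'` are mesh
  vertices of `D`, an edge segment inside `cl D'` is inside `cl D`, and membership in the discrete
  domain `Ω_δ = embMeshDomain` (a union of max-`ncard` mesh components) propagates from
  `a δ ∈ Ω_δ` along mesh edges (`HexEndpointApprox.mem_embMeshDomain_of_adj`, inductively: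
  `wn_darts_adj_embDomainGraph`); then `Walk.transfer`, `IsPath.transfer`, `support_transfer`.
* (ii) every `Ω_δ`-SAW whose curve class lies in the open event
  `O_ε = {γ | ∀ z ∈ range γ, ∀ k ∈ K, ε < dist z k}` is, with the same support, an `Ω'_δ`-SAW
  (`wn_transfer_of_far`): its mesh points lie in `D ∖ K ⊆ D'`, every edge segment lies in the
  range of the polyline (`wn_segment_subset_range_toCurve`) and in `cl D ⊆ cl D' ∪ K`, hence in
  `cl D'`, and `a δ ∈ Ω'_δ`.

Subtleties. Mesh adjacency (`embMeshGraph`) requires the edge SEGMENT to lie in the closure of the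
domain, not only its endpoints; the endpoints lie in the discrete domains only once they are
distinct and joined there (`wn_mem_embMeshDomain_of_reachable_ne`), and `a δ ≠ b δ` eventually
because the marked points of a Dobrushin domain are distinct (`MarkedDomain.pt_injective`,
`wn_eventually_mem_embMeshDomain`).

Why. Consumed by stub R `stub_windowRestrictionDefect_of_mixing` (its first hypothesis: the
two-sided comparison of the window laws is then a statement about ONE set of walks carrying two
weights) and, conceptually, by the passage stub 2b (hull restriction of the limit).

Credit: extracted from the wave-1 audit of stub 2a (`work/stubs/AuditWindowRestrictionDefect.lean`,
declarations `wrd_darts_adj_embDomainGraph` … `wrd_eventually_nesting`, renamed `wn_…`).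

References: G. F. Lawler, O. Schramm, W. Werner, J. Amer. Math. Soc. 16 (2003), §1 (restriction to
`D ∖ A` for hulls `A`); H. Duminil-Copin, S. Smirnov, Ann. of Math. 175 (2012), §4 (discrete
domains `Ω_δ` of the honeycomb lattice).
-/

noncomputable section

namespace Summit.CriticalPhenomena.SAWScalingLimit.Theorems.MassiveWindowSLE.Birth

open scoped Topology
open Filter Set
open Literature.Probability Literature.Probability.LatticeModels
  Literature.Probability.RandomPlanarGeometry

/-! ### Transfer of walks between nested discrete domains -/

section Transfer

variable {V : Type*} {G : SimpleGraph V} {emb : V → ℂ} {Ω Ω' : Set ℂ} {δ : ℝ}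

/-- Propagation of membership in `Ω_δ` along a walk: if a walk (of any graph) starts in
`Ω_δ = embMeshDomain` and each of its darts is an edge of the mesh graph ending at a mesh vertex,
then each dart is an edge of the domain graph `embDomainGraph` (the discrete domain is a union of
mesh components, `HexEndpointApprox.mem_embMeshDomain_of_adj`, inductively). -/
theorem wn_darts_adj_embDomainGraph {H : SimpleGraph V} :
    ∀ {u w : V} (p : H.Walk u w), u ∈ SAW.embMeshDomain G emb Ω δ →
      (∀ d ∈ p.darts, (SAW.embMeshGraph G emb Ω δ).Adj d.fst d.snd ∧
        d.snd ∈ SAW.embMeshVertices emb Ω δ) →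
      ∀ d ∈ p.darts, (SAW.embDomainGraph G emb Ω δ).Adj d.fst d.snd
  | _, _, .nil, _, _ => by simp
  | u, w, .cons (v := v) h p, hu, hd => by
    intro d hd'
    rw [SimpleGraph.Walk.darts_cons, List.mem_cons] at hd'
    obtain ⟨hadj, hv⟩ := hd ⟨(u, v), h⟩ (by simp)
    have huV : u ∈ SAW.embMeshVertices emb Ω δ := SAW.embMeshDomain_subset G emb Ω δ hu
    have hv' : v ∈ SAW.embMeshDomain G emb Ω δ :=
      HexEndpointApprox.mem_embMeshDomain_of_adj (u := ⟨u, huV⟩) (w := ⟨v, hv⟩) hu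
        (by simpa only [SimpleGraph.comap_adj, Function.Embedding.subtype_apply] using hadj)
    rcases hd' with rfl | hd'
    · exact (SAW.embDomainGraph_adj_iff G emb).2 ⟨hadj, hu, hv'⟩
    · exact wn_darts_adj_embDomainGraph p hv' (fun d hd'' => hd d (by simp [hd''])) d hd'

/-- Darts adjacent in `H'` give edges in `H'.edgeSet` (the hypothesis of `Walk.transfer`). -/
theorem wn_edges_mem_of_darts {H H' : SimpleGraph V} {u w : V} (p : H.Walk u w)
    (h : ∀ d ∈ p.darts, H'.Adj d.fst d.snd) : ∀ e ∈ p.edges, e ∈ H'.edgeSet := by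
  intro e he
  rw [SimpleGraph.Walk.edges, List.mem_map] at he
  obtain ⟨d, hd, rfl⟩ := he
  exact (SimpleGraph.mem_edgeSet (G := H')).2 (h d hd)

/-- **Nesting, easy direction (`Ω'_δ`-walks are `Ω_δ`-walks).** If `Ω' ⊆ Ω` and the common
origin `a` lies in the big discrete domain `Ω_δ`, every SAW of `Ω'_δ` from `a` is, with the same
support, a SAW of `Ω_δ`: mesh vertices of `Ω'` are mesh vertices of `Ω`, a segment inside `cl Ω'`
is inside `cl Ω`, and the walk stays in the mesh component of `a`, which is maximal. -/
theorem wn_transfer_of_subset (hΩ : Ω' ⊆ Ω) {a b : V} (ha : a ∈ SAW.embMeshDomain G emb Ω δ)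
    (γ' : SAW.EmbDomainSAW G emb Ω' δ a b) :
    ∃ γ : SAW.EmbDomainSAW G emb Ω δ a b, γ.walk.support = γ'.walk.support := by
  have hd : ∀ d ∈ γ'.walk.darts, (SAW.embDomainGraph G emb Ω δ).Adj d.fst d.snd := by
    refine wn_darts_adj_embDomainGraph γ'.walk ha fun d _ => ?_
    obtain ⟨hmesh, -, hsnd⟩ := (SAW.embDomainGraph_adj_iff G emb).1 d.adj
    obtain ⟨hG, hseg⟩ := (SAW.embMeshGraph_adj_iff G emb).1 hmesh
    exact ⟨(SAW.embMeshGraph_adj_iff G emb).2 ⟨hG, hseg.trans (closure_mono hΩ)⟩,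
      hΩ (SAW.embMeshDomain_subset G emb Ω' δ hsnd)⟩
  exact ⟨⟨γ'.walk.transfer _ (wn_edges_mem_of_darts _ hd), γ'.isPath.transfer _⟩,
    SimpleGraph.Walk.support_transfer _ _⟩

/-- The polyline of a walk contains the segment of each of its darts. -/
theorem wn_segment_subset_range_toCurve {H : SimpleGraph V} (f : V → ℂ) :
    ∀ {u w : V} (p : H.Walk u w), ∀ d ∈ p.darts,
      segment ℝ (f d.fst) (f d.snd) ⊆ Set.range (p.toCurve f)
  | _, _, .nil => by simp
  | u, w, .cons (v := v) h p => by
    -- adapted from `SimpleGraph.Walk.range_toCurve_cons` (Literature/Probability/Percolation/CLE6Proofs.lean)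
    have hcons : Set.range ((SimpleGraph.Walk.cons h p).toCurve f) =
        segment ℝ (f u) (f v) ∪ Set.range (p.toCurve f) := by
      cases p <;> simp [SimpleGraph.Walk.toCurve, LatticeModels.polyline, Path.trans_range,
        Path.range_segment]
    intro d hd
    rw [hcons]
    rw [SimpleGraph.Walk.darts_cons, List.mem_cons] at hd
    rcases hd with rfl | hd
    · exact subset_union_left
    · exact (wn_segment_subset_range_toCurve f p d hd).trans subset_union_right

/-- **Nesting, hard direction (`Ω_δ`-walks far from the removed hull are `Ω'_δ`-walks).** If
`Ω' ⊆ Ω`, the common origin `a` lies in the SMALL discrete domain `Ω'_δ`, and the polyline of a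
SAW `γ` of `Ω_δ` from `a` misses `cl (Ω ∖ Ω')`, then `γ` is, with the same support, a SAW of
`Ω'_δ`: its mesh points lie in `Ω ∖ cl (Ω ∖ Ω') ⊆ Ω'`, its edge segments lie in
`cl Ω ∖ cl (Ω ∖ Ω') ⊆ cl Ω'` (as `cl Ω = cl Ω' ∪ cl (Ω ∖ Ω')`), so consecutive vertices are
adjacent in the mesh graph of `Ω'` and the walk stays in the (maximal) mesh component of `a`. -/
theorem wn_transfer_of_far (hΩ : Ω' ⊆ Ω) {a b : V} (ha : a ∈ SAW.embMeshDomain G emb Ω' δ)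
    (γ : SAW.EmbDomainSAW G emb Ω δ a b)
    (hfar : Disjoint (Set.range (γ.walk.toCurve fun v => (δ : ℂ) * emb v)) (closure (Ω \ Ω'))) :
    ∃ γ' : SAW.EmbDomainSAW G emb Ω' δ a b, γ'.walk.support = γ.walk.support := by
  have hcl : closure Ω ⊆ closure Ω' ∪ closure (Ω \ Ω') := by
    rw [← closure_union]
    exact closure_mono (Set.union_sdiff_cancel hΩ).symm.subset
  have hd : ∀ d ∈ γ.walk.darts, (SAW.embDomainGraph G emb Ω' δ).Adj d.fst d.snd := by
    refine wn_darts_adj_embDomainGraph γ.walk ha fun d hd => ?_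
    obtain ⟨hmesh, -, hsnd⟩ := (SAW.embDomainGraph_adj_iff G emb).1 d.adj
    obtain ⟨hG, hseg⟩ := (SAW.embMeshGraph_adj_iff G emb).1 hmesh
    have hsegR := wn_segment_subset_range_toCurve (fun v => (δ : ℂ) * emb v) γ.walk d hd
    refine ⟨(SAW.embMeshGraph_adj_iff G emb).2 ⟨hG, fun z hz => ?_⟩, ?_⟩
    · rcases hcl (hseg hz) with h | h
      · exact h
      · exact absurd h (Set.disjoint_left.1 hfar (hsegR hz))
    · have hp : (δ : ℂ) * emb d.snd ∈ Ω := SAW.embMeshDomain_subset G emb Ω δ hsnd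
      have hpR : (δ : ℂ) * emb d.snd ∈ Set.range (γ.walk.toCurve fun v => (δ : ℂ) * emb v) :=
        hsegR (right_mem_segment ℝ _ _)
      show (δ : ℂ) * emb d.snd ∈ Ω'
      by_contra hp'
      exact Set.disjoint_left.1 hfar hpR (subset_closure ⟨hp, hp'⟩)
  exact ⟨⟨γ.walk.transfer _ (wn_edges_mem_of_darts _ hd), γ.isPath.transfer _⟩,
    SimpleGraph.Walk.support_transfer _ _⟩

/-- Distinct endpoints joined in `Ω_δ` lie in `Ω_δ` (the first edge of a joining walk). -/
theorem wn_mem_embMeshDomain_of_reachable_ne {a b : V}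
    (h : (SAW.embDomainGraph G emb Ω δ).Reachable a b) (hab : a ≠ b) :
    a ∈ SAW.embMeshDomain G emb Ω δ := by
  obtain ⟨p⟩ := h
  cases p with
  | nil => exact absurd rfl hab
  | cons hadj _ => exact ((SAW.embDomainGraph_adj_iff G emb).1 hadj).2.1

end Transfer

/-! ### Honeycomb SAWs of Dobrushin domains: nesting for admissible data, eventually -/

/-- The trace of the curve class of a SAW is the range of its polyline (definitional). -/
theorem wn_curve_range_eq {Ω : Set ℂ} {δ : ℝ} {a b : HexVertex} (γ : SAW.HexDomainSAW Ω δ a b) :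
    γ.curve.range = Set.range (γ.walk.toCurve fun v => (δ : ℂ) * hexCenter v) :=
  rfl

/-- Mesh points of a SAW lie on its polyline, so `curve ∈ O_ε` implies that every support vertex
is `ε`-far from `K` (the hypothesis form of the ratio-mixing stub M). -/
theorem wn_support_far_of_curve_mem {Ω : Set ℂ} {δ : ℝ} {a b : HexVertex} {K : Set ℂ} {ε : ℝ}
    (γ : SAW.HexDomainSAW Ω δ a b)
    (h : γ.curve ∈ {c : CurveClass ℂ | ∀ z ∈ c.range, ∀ k ∈ K, ε < dist z k}) :
    ∀ v ∈ γ.walk.support, ∀ k ∈ K, ε < dist ((δ : ℂ) * hexCenter v) k := fun v hv k hk =>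
  h _ (by rw [wn_curve_range_eq]; exact SimpleGraph.Walk.mem_range_toCurve _ γ.walk hv) k hk

/-- Along an endpoint approximation the endpoints eventually differ and lie in the discrete
domain (the marked points of a Dobrushin domain are distinct, `MarkedDomain.pt_injective`). -/
theorem wn_eventually_mem_embMeshDomain {D : DobrushinDomain} {a b : ℝ → HexVertex}
    (h : SAW.IsEmbEndpointApprox hexGraph hexCenter D a b) :
    ∀ᶠ δ in 𝓝[>] (0 : ℝ), a δ ≠ b δ ∧ a δ ∈ SAW.embMeshDomain hexGraph hexCenter D.carrier δ ∧
      b δ ∈ SAW.embMeshDomain hexGraph hexCenter D.carrier δ := by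
  have hne : D.pt 0 ≠ D.pt 1 := fun h' => absurd (D.pt_injective h') (by decide)
  have hev : ∀ᶠ δ : ℝ in 𝓝[>] (0 : ℝ),
      (((δ : ℝ) : ℂ) * hexCenter (a δ), ((δ : ℝ) : ℂ) * hexCenter (b δ)) ∈ (Set.diagonal ℂ)ᶜ :=
    (h.tendsto_fst.prodMk_nhds h.tendsto_snd).eventually_mem
      (isClosed_diagonal.isOpen_compl.mem_nhds (by simpa using hne))
  filter_upwards [h.reachable, hev] with δ hr hδ
  have hab : a δ ≠ b δ := by
    intro h'
    apply hδ
    simp [h']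
  exact ⟨hab, wn_mem_embMeshDomain_of_reachable_ne hr hab,
    wn_mem_embMeshDomain_of_reachable_ne hr.symm hab.symm⟩

/-- **Nesting for admissible data, eventually.** For a hull pair `D' ⊆ D` with COMMON endpoint
approximations and every `ε > 0`, for all small `δ`: (i) every `Ω'_δ`-SAW `a δ → b δ` is, with
the same support (hence the same polyline, `SAW.EmbDomainSAW.curve_eq_of_support_eq`, and the
same vertex count), an `Ω_δ`-SAW; (ii) every `Ω_δ`-SAW whose curve class lies in the open event
`O_ε = {γ | ∀ z ∈ range γ, ∀ k ∈ cl (D ∖ D'), ε < dist z k}` is, with the same support, an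
`Ω'_δ`-SAW (a point `z = k` common to the polyline and `cl (D ∖ D')` would give `ε < 0`). -/
theorem wn_eventually_nesting {D D' : DobrushinDomain} (hDD' : D.IsHullSubdomain D')
    {a b : ℝ → HexVertex} (ha : SAW.IsEmbEndpointApprox hexGraph hexCenter D a b)
    (ha' : SAW.IsEmbEndpointApprox hexGraph hexCenter D' a b) {ε : ℝ} (hε : 0 < ε) :
    ∀ᶠ δ in 𝓝[>] (0 : ℝ),
      (∀ γ' : SAW.HexDomainSAW D'.carrier δ (a δ) (b δ),
          ∃ γ : SAW.HexDomainSAW D.carrier δ (a δ) (b δ), γ.walk.support = γ'.walk.support) ∧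
      (∀ γ : SAW.HexDomainSAW D.carrier δ (a δ) (b δ),
          γ.curve ∈ {c : CurveClass ℂ | ∀ z ∈ c.range, ∀ k ∈ closure (D.carrier \ D'.carrier),
            ε < dist z k} →
          ∃ γ' : SAW.HexDomainSAW D'.carrier δ (a δ) (b δ), γ'.walk.support = γ.walk.support) := by
  filter_upwards [wn_eventually_mem_embMeshDomain ha, wn_eventually_mem_embMeshDomain ha']
    with δ hδ hδ'
  refine ⟨fun γ' => wn_transfer_of_subset hDD'.carrier_subset hδ.2.1 γ',
    fun γ hγ => wn_transfer_of_far hDD'.carrier_subset hδ'.2.1 γ ?_⟩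
  rw [Set.disjoint_left]
  intro z hz hzK
  have h := hγ z (by rwa [wn_curve_range_eq]) z hzK
  rw [dist_self] at h
  exact lt_irrefl _ (hε.trans h)

/-! ### The registered stub -/

/-- **Stub N (lattice geometry — r6 split of 2a): NESTING along common endpoints.**
For a hull pair `D' ⊆ D` with a common endpoint approximation and `ε > 0`, for all small `δ`:
(i) every `Ω'_δ`-SAW from `a δ` to `b δ` is, with the same support, an `Ω_δ`-SAW (segments in
`cl D' ⊆ cl D`; membership in the largest mesh component propagates from `a δ ∈ Ω_δ` along mesh
edges); (ii) every `Ω_δ`-SAW whose curve class lies in `O_ε` (polyline `ε`-away from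
`cl (D ∖ D')`) is, with the same support, an `Ω'_δ`-SAW (mesh points in `D ∖ cl (D∖D') ⊆ D'`, edge
segments ⊆ range of the polyline ⊆ `cl D ∖ cl (D∖D') ⊆ cl D'`, and `a δ ∈ Ω'_δ`). This is
`wn_eventually_nesting` with explicit binders, in the registered (fully qualified) form. -/
theorem stub_windowNesting :
    ∀ (D D' : Literature.Probability.RandomPlanarGeometry.DobrushinDomain), D.IsHullSubdomain D' → ∀ (a b : ℝ → Literature.Probability.LatticeModels.HexVertex), Literature.Probability.RandomPlanarGeometry.SAW.IsEmbEndpointApprox Literature.Probability.LatticeModels.hexGraph Literature.Probability.LatticeModels.hexCenter D a b → Literature.Probability.RandomPlanarGeometry.SAW.IsEmbEndpointApprox Literature.Probability.LatticeModels.hexGraph Literature.Probability.LatticeModels.hexCenter D' a b → ∀ ε : ℝ, 0 < ε → ∀ᶠ δ in nhdsWithin 0 (Set.Ioi 0), (∀ γ' : Literature.Probability.RandomPlanarGeometry.SAW.HexDomainSAW D'.carrier δ (a δ) (b δ), ∃ γ : Literature.Probability.RandomPlanarGeometry.SAW.HexDomainSAW D.carrier δ (a δ) (b δ), γ.walk.support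 = γ'.walk.support) ∧ (∀ γ : Literature.Probability.RandomPlanarGeometry.SAW.HexDomainSAW D.carrier δ (a δ) (b δ), γ.curve ∈ {γ : Literature.Probability.RandomPlanarGeometry.CurveClass ℂ | ∀ z ∈ γ.range, ∀ k ∈ closure (D.carrier \ D'.carrier), ε < dist z k} → ∃ γ' : Literature.Probability.RandomPlanarGeometry.SAW.HexDomainSAW D'.carrier δ (a δ) (b δ), γ'.walk.support = γ.walk.support) := by
  intro D D' hDD' a b ha ha' ε hε
  exact wn_eventually_nesting hDD' ha ha' hε

end Summit.CriticalPhenomena.SAWScalingLimit.Theorems.MassiveWindowSLE.Birth
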